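import Mathlib.GroupTheory.Perm.Closure
import Mathlib.GroupTheory.Perm.Fin
import Literature.NumberTheory.GaloisRepresentations.GSpValued
import Literature.NumberTheory.FaltingsSerre.GSp4F2
import HarnessLib

/-!
# The Faltings–Serre method after Brumer–Pacetti–Poor–Tornaría–Voight–Yuen, V:
# `ι : S₆ → Sp₄(𝔽₂)` is an injective homomorphism into the symplectic group — PROVED;
# the `S₅(b)` trace signature (5.1.8) for ALL elements — kernel-checked

[BPPTVY] = A. Brumer, A. Pacetti, C. Poor, G. Tornaría, J. Voight, D. S. Yuen, *On the paramodularity of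
typical abelian surfaces*, Algebra & Number Theory **13**:5 (2019) 1145–1195 [cite: BrumerEtAl2019],
§5.1, pp. 1173–1174 (PRINTED numbering and pages).  Verbatim, p. 1173: "We have an isomorphism
`ι : S₆ ⥲ Sp₄(𝔽₂)` … which we make explicit in the following manner. Let `U := 𝔽₂⁶`, and equip `U`
with the coordinate action of `S₆` and the standard nondegenerate alternating (equivalently,
symmetric) bilinear form … Let `U⁰ ⊂ U` be the trace `0` hyperplane, let `L` be the `𝔽₂`-span of
`(1,…,1)`, and let `Z := U⁰/L` be the quotient, so `dim Z = 4`. Then `Z` inherits both an action of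
`S₆` and a symplectic pairing, which remains nondegenerate"; Lemma 5.1.7 with (5.1.8), p. 1173:
"`S₅(b)` | `120` | `1,…,6` | elements of order `3, 6` have trace `1`"; p. 1173 (after Lemma 5.1.5):
"There is a unique outer automorphism of `S₆` up to inner automorphisms; it … interchanges the
trace of some order `3` and order `6` elements."

`Literature.NumberTheory.FaltingsSerre.GSp4F2.iota` (file `GSp4F2.lean`) is the construction
`ι(σ) := Q · P(σ) · E` of [BPPTVY, (5.1.1)]; there only its values on the printed generators were
kernel-checked and "that `ι` is a group isomorphism `S₆ ⥲ Sp₄(𝔽₂)` is the cited statement … NOT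
re-proved".  THIS FILE PROVES, with standard axioms only (no `native_decide`):
* `GSp4F2.iota_mul`, `GSp4F2.iota_one`, `GSp4F2.iotaHom` — `ι` is a homomorphism
  `S₆ → M₄(𝔽₂)` (so `U⁰/L` really is an `S₆`-module in the basis `e`): the coordinate action
  `P` is multiplicative and `E · Q` is the identity of `U⁰` MODULO `L` (checked on the fifteen weight-2
  vectors, which is all that is used), while `Q` kills `L` and `P(σ)` fixes `L`;
* `GSp4F2.iota_isSimilitude` — every `ι(σ)` preserves the anti-identity Gram matrix `J`
  (`ι(σ)ᵀ J ι(σ) = J`, i.e. `ι(S₆) ≤ Sp₄(𝔽₂)`): by `S₆ = ⟨(1 2 3 4 5 6), (1 2)⟩`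
  (`Equiv.Perm.closure_cycle_adjacent_swap`) and the homomorphism property, from two kernel checks;
* `GSp4F2.iota_injective`, `GSp4F2.iotaGL_injective` — `ι` is injective: `ι(σ) = 1` forces `σ` to
  stabilise the four pairs `{1,2}, {3,4}, {4,5}, {2,6}` underlying `e₁,…,e₄` (the retraction `Q` separates
  the fifteen pair-vectors, kernel check), hence `σ = 1`;
* `GSp4F2.orderOf_iota` — `ι` preserves element orders (the "orders" columns of Lemmas 5.1.5/5.1.7
  are read off in `S₆`);
* `GSp4F2.trace_iota` — the trace formula `tr ι(σ) = ∑ₗ (E·Q)_{l,σ(l)}`, and with it, by kernel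
  enumeration of all `720` elements: `GSp4F2.trace_iota_eq_card_fixed` — `tr ι(σ) = #Fix(σ) mod 2`
  ([folklore]: the Brauer character of `U⁰/L`), so `tr ι(σ) = 1` exactly on the cycle types
  `(3,1³), (3,2,1), (5,1)`; the printed signature (5.1.8) for EVERY element:
  `GSp4F2.trace_eq_one_of_mem_S5b` — every `σ ∈ S₅(b) = Stab(6)` of order `3` or `6` has
  `tr ι(σ) = 1`; and `GSp4F2.trace_c123_c456` — the order-3 element `(1 2 3)(4 5 6) ∉ S₅(b)` has
  trace `0` (the class the outer automorphism exchanges with the 3-cycles; the `S₅(a)`/`S₅(b)`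
  distinction of Lemma 5.1.7).
NOT proved here: SURJECTIVITY of `ι` onto `Sp₄(𝔽₂)` (equivalently `#Sp₄(𝔽₂) = 720`, a count over
`M₄(𝔽₂)` outside comfortable kernel range) — for the certificates only "`ι` is an injective
homomorphism into `Sp₄(𝔽₂)`" is used (residual images are identified with permutation groups
through `ι`); and the classification half of Lemma 5.1.7 (nine absolutely irreducible subgroups).
Cell pub-paramod (referee rulings A4/A8): this is the in-kernel second implementation of the
`S₆ ≅ Sp₄(𝔽₂)` dictionary used by every instance (`N = 277, 353, 587, …`).

## References
* [BPPTVY] ANT 13:5 (2019), §5.1: (5.1.1)–(5.1.2), Lemma 5.1.5, Lemma 5.1.7 with (5.1.8),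
  Example 5.1.9, pp. 1173–1174. [cite: BrumerEtAl2019]
-/

namespace Literature.NumberTheory.FaltingsSerre.GSp4F2

open Matrix Equiv Equiv.Perm Finset
open Literature.NumberTheory.GaloisRepresentations (IsSimilitude isSimilitude_one_iff)

/-! ### A. The coordinate action `P : S₆ → M₆(𝔽₂)` is a homomorphism -/

/-- `P(1) = 1`. [cite: BrumerEtAl2019, §5.1 p. 1173] -/
theorem permAction_one : permAction 1 = 1 := by
  ext i j
  simp only [permAction, Matrix.of_apply, Perm.one_apply, Matrix.one_apply]
  rcases eq_or_ne i j with rfl | h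
  · simp
  · simp [h, Ne.symm h]

/-- Right multiplication by `P(σ)` permutes columns: `(A · P(σ))_{i,l} = A_{i,σ(l)}`. [folklore] -/
theorem mul_permAction_apply {m : Type*} (A : Matrix m (Fin 6) (ZMod 2)) (σ : Perm (Fin 6)) (i : m)
    (l : Fin 6) : (A * permAction σ) i l = A i (σ l) := by
  simp only [Matrix.mul_apply, permAction, Matrix.of_apply, mul_ite, mul_one, mul_zero]
  rw [Finset.sum_ite_eq]
  simp

/-- Left multiplication by `P(σ)` permutes rows: `(P(σ) · B)_{l,j} = B_{σ⁻¹(l),j}`. [folklore] -/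
theorem permAction_mul_apply {n : Type*} (B : Matrix (Fin 6) n (ZMod 2)) (σ : Perm (Fin 6))
    (l : Fin 6) (j : n) : (permAction σ * B) l j = B (σ⁻¹ l) j := by
  simp only [Matrix.mul_apply, permAction, Matrix.of_apply, ite_mul, one_mul, zero_mul]
  rw [Finset.sum_eq_single (σ⁻¹ l)]
  · simp
  · intro x _ hx
    rw [if_neg]
    intro h
    exact hx (by rw [← h]; simp)
  · intro h; exact absurd (Finset.mem_univ _) h

/-- `P(στ) = P(σ) P(τ)` (with `(σ * τ)(x) = σ(τ(x))`). [cite: BrumerEtAl2019, §5.1 p. 1173] -/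
theorem permAction_mul (σ τ : Perm (Fin 6)) : permAction (σ * τ) = permAction σ * permAction τ := by
  ext i l
  rw [mul_permAction_apply]
  simp [permAction, Perm.mul_apply]

/-- Closed form of the construction: `ι(σ)_{i,j} = ∑ₗ Q_{i,σ(l)} E_{l,j}`. [cite: BrumerEtAl2019, (5.1.1) p. 1173] -/
theorem iota_apply (σ : Perm (Fin 6)) (i j : Fin 4) :
    iota σ i j = ∑ l, projZ i (σ l) * basisZ l j := by
  unfold iota
  rw [Matrix.mul_apply]
  simp only [mul_permAction_apply]

/-! ### B. `E · Q ≡ 1 (mod L)` on the pair vectors, and `ι` is a homomorphism -/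

/-- `F := E · Q ∈ M₆(𝔽₂)` (explicit). [cite: BrumerEtAl2019, §5.1 p. 1173] -/
def F6 : Matrix (Fin 6) (Fin 6) (ZMod 2) :=
  !![0, 1, 0, 0, 0, 1;
     0, 1, 1, 1, 1, 0;
     0, 0, 0, 1, 1, 0;
     0, 0, 1, 0, 1, 0;
     0, 0, 1, 1, 0, 0;
     0, 0, 1, 1, 1, 1]

/-- Kernel check: `E · Q = F`. [cite: BrumerEtAl2019, §5.1 p. 1173] -/
theorem basisZ_mul_projZ : basisZ * projZ = F6 := by
  unfold basisZ projZ F6; decide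

/-- First letters of the pairs `e₁ = {1,2}, e₂ = {3,4}, e₃ = {4,5}, e₄ = {2,6}` (as `Fin 6` values). [cite: BrumerEtAl2019, §5.1 p. 1173] -/
def loIdx : Fin 4 → Fin 6 := ![0, 2, 3, 1]
/-- Second letters of the pairs `e₁, …, e₄`. [cite: BrumerEtAl2019, §5.1 p. 1173] -/
def hiIdx : Fin 4 → Fin 6 := ![1, 3, 4, 5]

/-- The indicator vector of `{a, b} ⊂ {1,…,6}` in `U = 𝔽₂⁶` (a weight-2 vector of `U⁰` when `a ≠ b`). [cite: BrumerEtAl2019, §5.1 p. 1173] -/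
def pair (a b : Fin 6) : Fin 6 → ZMod 2 := fun k => if k = a then 1 else if k = b then 1 else 0

/-- The two letters of each `eⱼ` are distinct. [cite: BrumerEtAl2019, §5.1 p. 1173] -/
theorem loIdx_ne_hiIdx : ∀ j : Fin 4, loIdx j ≠ hiIdx j := by
  unfold loIdx hiIdx; decide

/-- Column `j` of `E` is the pair vector `eⱼ`. [cite: BrumerEtAl2019, §5.1 p. 1173] -/
theorem basisZ_eq_pair : ∀ (l : Fin 6) (j : Fin 4), basisZ l j = pair (loIdx j) (hiIdx j) l := by
  unfold basisZ pair loIdx hiIdx; decide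

/-- Column `j` of `P(τ) · E` is the pair vector of `τ(eⱼ) = {τ aⱼ, τ bⱼ}`. [cite: BrumerEtAl2019, §5.1 p. 1173] -/
theorem permAction_mul_basisZ_apply (τ : Perm (Fin 6)) (k : Fin 6) (j : Fin 4) :
    (permAction τ * basisZ) k j = pair (τ (loIdx j)) (τ (hiIdx j)) k := by
  rw [permAction_mul_apply, basisZ_eq_pair]
  simp only [pair, Equiv.Perm.inv_eq_iff_eq]

/-- KERNEL CHECK (the heart of "`Z = U⁰/L` with coordinate map `Q`"): for every weight-2 vector
`x = {a,b}`, `F x − x` is a CONSTANT vector, i.e. lies in `L = {0, (1,…,1)}`. [cite: BrumerEtAl2019, §5.1 p. 1173] -/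
theorem F6_pair_const : ∀ a b : Fin 6, a ≠ b → ∀ k : Fin 6,
    (F6 *ᵥ pair a b) k - pair a b k = (F6 *ᵥ pair a b) 0 - pair a b 0 := by
  unfold F6 pair; decide

/-- Every row of `Q` has even weight: `Q (1,…,1) = 0` entrywise. [cite: BrumerEtAl2019, §5.1 p. 1173] -/
theorem projZ_row_sum : ∀ i : Fin 4, ∑ k, projZ i k = 0 := by
  unfold projZ; decide

/-- **`ι` is multiplicative**: `ι(στ) = ι(σ) ι(τ)`.  Proof: `ι(σ)ι(τ) − ι(στ) = Q P(σ) (F − 1) P(τ) E`;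
each column of `(F − 1) P(τ) E` is constant (`F6_pair_const`), `P(σ)` fixes constant columns and
`Q` kills them (`projZ_row_sum`). [cite: BrumerEtAl2019, §5.1 (5.1.1) p. 1173] -/
theorem iota_mul (σ τ : Perm (Fin 6)) : iota (σ * τ) = iota σ * iota τ := by
  ext i j
  have lhs : iota (σ * τ) i j = ∑ k, projZ i (σ k) * (permAction τ * basisZ) k j := by
    unfold iota
    rw [permAction_mul, ← Matrix.mul_assoc, Matrix.mul_assoc (projZ * permAction σ) (permAction τ) basisZ,
      Matrix.mul_apply]
    simp only [mul_permAction_apply]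
  have rhs : (iota σ * iota τ) i j =
      ∑ k, projZ i (σ k) * (basisZ * projZ * (permAction τ * basisZ)) k j := by
    unfold iota
    rw [show projZ * permAction σ * basisZ * (projZ * permAction τ * basisZ) =
        projZ * permAction σ * (basisZ * projZ * (permAction τ * basisZ)) by
      simp only [Matrix.mul_assoc]]
    rw [Matrix.mul_apply]
    simp only [mul_permAction_apply]
  rw [lhs, rhs]
  -- the column-`j` difference `(F − 1) τ(eⱼ)` is a constant vector
  have hab : τ (loIdx j) ≠ τ (hiIdx j) := fun e => loIdx_ne_hiIdx j (τ.injective e)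
  have hcol : ∀ k, (basisZ * projZ * (permAction τ * basisZ)) k j =
      (permAction τ * basisZ) k j +
        ((F6 *ᵥ pair (τ (loIdx j)) (τ (hiIdx j))) 0 - pair (τ (loIdx j)) (τ (hiIdx j)) 0) := by
    intro k
    have h1 : (basisZ * projZ * (permAction τ * basisZ)) k j =
        (F6 *ᵥ pair (τ (loIdx j)) (τ (hiIdx j))) k := by
      rw [basisZ_mul_projZ, Matrix.mul_apply]
      simp only [permAction_mul_basisZ_apply, Matrix.mulVec, dotProduct]
    rw [h1, permAction_mul_basisZ_apply, ← F6_pair_const _ _ hab k]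
    ring
  simp only [hcol, mul_add, Finset.sum_add_distrib]
  rw [← Finset.sum_mul, Equiv.sum_comp σ (projZ i), projZ_row_sum i, zero_mul, add_zero]

/-- `ι(1) = 1`. [cite: BrumerEtAl2019, (5.1.1) p. 1173] -/
theorem iota_one : iota 1 = 1 := by
  unfold iota; rw [permAction_one, Matrix.mul_one, projZ_mul_basisZ]

/-- `ι` as a monoid homomorphism `S₆ → M₄(𝔽₂)`. [cite: BrumerEtAl2019, (5.1.1) p. 1173] -/
def iotaHom : Perm (Fin 6) →* Matrix (Fin 4) (Fin 4) (ZMod 2) where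
  toFun := iota
  map_one' := iota_one
  map_mul' := iota_mul

/-- `ι` as a group homomorphism `S₆ → GL₄(𝔽₂)`. [cite: BrumerEtAl2019, (5.1.1) p. 1173] -/
def iotaGL : Perm (Fin 6) →* GL (Fin 4) (ZMod 2) := iotaHom.toHomUnits

/-- The underlying matrix of `iotaGL σ` is `ι(σ)`. [cite: BrumerEtAl2019, (5.1.1) p. 1173] -/
@[simp] theorem coe_iotaGL (σ : Perm (Fin 6)) : ((iotaGL σ : GL (Fin 4) (ZMod 2)) : Matrix _ _ _) = iota σ :=
  rfl

/-! ### C. `ι(S₆) ≤ Sp₄(𝔽₂)` -/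

/-- KERNEL CHECK: the images of the 6-cycle `(1 2 3 4 5 6)` (`finRotate 6`) and of `(1 2)` preserve `J`. [cite: BrumerEtAl2019, (5.1.1)–(5.1.2) p. 1173] -/
theorem iota_generators_symplectic :
    (iota (finRotate 6))ᵀ * antiId4 (ZMod 2) * iota (finRotate 6) = antiId4 (ZMod 2) ∧
      (iota (swap 0 (finRotate 6 0)))ᵀ * antiId4 (ZMod 2) * iota (swap 0 (finRotate 6 0)) =
        antiId4 (ZMod 2) := by
  unfold iota projZ basisZ permAction antiId4
  constructor <;> decide

/-- **`ι(S₆) ≤ Sp₄(𝔽₂)`**: `ι(σ)ᵀ J ι(σ) = J` for every `σ ∈ S₆` (`J` the anti-identity Gram matrix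
of `Z`).  From the two generators `(1 2 3 4 5 6)`, `(1 2)` of `S₆` and `iota_mul`. [cite: BrumerEtAl2019, (5.1.1)–(5.1.2) p. 1173] -/
theorem iota_symplectic (σ : Perm (Fin 6)) :
    (iota σ)ᵀ * antiId4 (ZMod 2) * iota σ = antiId4 (ZMod 2) := by
  have htop := closure_cycle_adjacent_swap (isCycle_finRotate (n := 4)) (support_finRotate (n := 4))
    (0 : Fin 6)
  have hmem : σ ∈ Subgroup.closure
      ({finRotate (4 + 2), swap (0 : Fin 6) (finRotate (4 + 2) 0)} : Set (Perm (Fin 6))) := by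
    rw [htop]; exact Subgroup.mem_top σ
  induction hmem using Subgroup.closure_induction with
  | mem x hx =>
    simp only [Set.mem_insert_iff, Set.mem_singleton_iff] at hx
    rcases hx with rfl | rfl
    · exact iota_generators_symplectic.1
    · exact iota_generators_symplectic.2
  | one => rw [iota_one]; simp
  | mul x y _ _ hx hy =>
    rw [iota_mul, Matrix.transpose_mul,
      show (iota y)ᵀ * (iota x)ᵀ * antiId4 (ZMod 2) * (iota x * iota y) =
        (iota y)ᵀ * ((iota x)ᵀ * antiId4 (ZMod 2) * iota x) * iota y by simp only [Matrix.mul_assoc],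
      hx, hy]
  | inv x _ hx =>
    have h1 : iota x * iota x⁻¹ = 1 := by rw [← iota_mul, mul_inv_cancel, iota_one]
    calc (iota x⁻¹)ᵀ * antiId4 (ZMod 2) * iota x⁻¹
        = (iota x⁻¹)ᵀ * ((iota x)ᵀ * antiId4 (ZMod 2) * iota x) * iota x⁻¹ := by rw [hx]
      _ = (iota x * iota x⁻¹)ᵀ * antiId4 (ZMod 2) * (iota x * iota x⁻¹) := by
          rw [Matrix.transpose_mul]; simp only [Matrix.mul_assoc]
      _ = antiId4 (ZMod 2) := by rw [h1]; simp

/-- The same in the tree's vocabulary: `ι(σ)` is a similitude of `J` with multiplier `1`. [cite: BrumerEtAl2019, (5.1.2) p. 1173] -/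
theorem iota_isSimilitude (σ : Perm (Fin 6)) : IsSimilitude (antiId4 (ZMod 2)) 1 (iota σ) :=
  isSimilitude_one_iff.mpr (iota_symplectic σ)

/-! ### D. `ι` is injective -/

/-- KERNEL CHECK: `Q` separates the fifteen pair vectors (they are pairwise distinct in `Z = U⁰/L`). [cite: BrumerEtAl2019, §5.1 p. 1173] -/
theorem projZ_pair_inj : ∀ a b c d : Fin 6, a ≠ b → c ≠ d →
    projZ *ᵥ pair a b = projZ *ᵥ pair c d → (a = c ∧ b = d) ∨ (a = d ∧ b = c) := by
  unfold projZ pair; decide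

/-- Column `j` of `ι(σ)` is `Q` of the pair vector `σ(eⱼ)`. [cite: BrumerEtAl2019, (5.1.1) p. 1173] -/
theorem iota_apply_eq_mulVec (σ : Perm (Fin 6)) (i j : Fin 4) :
    iota σ i j = (projZ *ᵥ pair (σ (loIdx j)) (σ (hiIdx j))) i := by
  unfold iota
  rw [Matrix.mul_assoc, Matrix.mul_apply]
  simp only [permAction_mul_basisZ_apply, Matrix.mulVec, dotProduct]

/-- `ι(σ) = 1 ⟹ σ = 1`: `σ` stabilises the pairs `{1,2}, {3,4}, {4,5}, {2,6}`, hence fixes every letter. [cite: BrumerEtAl2019, §5.1 p. 1173] -/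
theorem eq_one_of_iota_eq_one {σ : Perm (Fin 6)} (h : iota σ = 1) : σ = 1 := by
  have key : ∀ j : Fin 4, (σ (loIdx j) = loIdx j ∧ σ (hiIdx j) = hiIdx j) ∨
      (σ (loIdx j) = hiIdx j ∧ σ (hiIdx j) = loIdx j) := by
    intro j
    refine projZ_pair_inj _ _ _ _ (fun e => loIdx_ne_hiIdx j (σ.injective e)) (loIdx_ne_hiIdx j) ?_
    funext i
    rw [← iota_apply_eq_mulVec, h, ← projZ_mul_basisZ, Matrix.mul_apply]
    simp only [basisZ_eq_pair, Matrix.mulVec, dotProduct]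
  have h0 := key 0
  have h1 := key 1
  have h2 := key 2
  have h3 := key 3
  simp only [loIdx, hiIdx, Matrix.cons_val_zero, Matrix.cons_val_one, Matrix.cons_val] at h0 h1 h2 h3
  ext x
  rw [Perm.one_apply]
  fin_cases x <;>
    rcases h0 with ⟨h00, h01⟩ | ⟨h00, h01⟩ <;> rcases h1 with ⟨h10, h11⟩ | ⟨h10, h11⟩ <;>
      rcases h2 with ⟨h20, h21⟩ | ⟨h20, h21⟩ <;> rcases h3 with ⟨h30, h31⟩ | ⟨h30, h31⟩ <;>
        simp_all

/-- **`ι` is injective.** [cite: BrumerEtAl2019, §5.1 p. 1173] -/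
theorem iotaGL_injective : Function.Injective iotaGL :=
  (injective_iff_map_eq_one iotaGL).mpr fun σ h => eq_one_of_iota_eq_one (by
    rw [← coe_iotaGL, h]; rfl)

/-- **`ι` is injective** (matrix form: `ι(σ) = ι(τ) ⟹ σ = τ` on `S₆ = Perm (Fin 6)`). [cite: BrumerEtAl2019, §5.1 p. 1173] -/
theorem iota_injective : ∀ σ τ : Perm (Fin 6), iota σ = iota τ → σ = τ := fun _ _ h =>
  iotaGL_injective (Units.ext (by rw [coe_iotaGL, coe_iotaGL, h]))

/-- `ι` preserves orders of elements (injective homomorphism), so the "orders" columns of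
[BPPTVY, Lemma 5.1.5, Lemma 5.1.7] may be read off in `S₆`. [cite: BrumerEtAl2019, Lemma 5.1.5 p. 1173] -/
theorem orderOf_iota (σ : Perm (Fin 6)) : orderOf (iota σ) = orderOf σ :=
  orderOf_injective iotaHom (fun _ _ h => iota_injective _ _ h) σ

/-- Same for `ι : S₆ → GL₄(𝔽₂)`. [cite: BrumerEtAl2019, Lemma 5.1.5 p. 1173] -/
theorem orderOf_iotaGL (σ : Perm (Fin 6)) : orderOf (iotaGL σ) = orderOf σ :=
  orderOf_injective iotaGL iotaGL_injective σ

/-! ### E. The trace of `ι(σ)` and the `S₅(b)` signature (5.1.8), for all elements -/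

/-- Trace formula: `tr ι(σ) = ∑ₗ F_{l, σ(l)}`. [cite: BrumerEtAl2019, §5.1 p. 1173] -/
theorem trace_iota (σ : Perm (Fin 6)) : Matrix.trace (iota σ) = ∑ l, F6 l (σ l) := by
  simp only [Matrix.trace, Matrix.diag, iota_apply]
  rw [Finset.sum_comm]
  refine Finset.sum_congr rfl fun l _ => ?_
  rw [← basisZ_mul_projZ, Matrix.mul_apply]
  exact Finset.sum_congr rfl fun i _ => mul_comm _ _

set_option maxRecDepth 200000 in
/-- KERNEL CHECK over all `720` elements of `S₆` (`decide +kernel`): `∑ₗ F_{l,σ(l)} = #Fix(σ) mod 2`. [folklore] -/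
theorem traceSum_eq_card_fixed : ∀ σ : Perm (Fin 6),
    (∑ l, F6 l (σ l)) = ((#{x | σ x = x} : ℕ) : ZMod 2) := by
  decide +kernel

/-- **Trace formula `tr ι(σ) = #Fix(σ) (mod 2)`** for every `σ ∈ S₆`: the Brauer character of
`Z = U⁰/L` is that of the permutation module `U = 𝔽₂⁶` minus the two trivial constituents `L` and
`U/U⁰` (traces add along the filtration `0 ⊂ L ⊂ U⁰ ⊂ U`).  Hence `tr ι(σ) = 1` exactly for the cycle
types `(3,1,1,1), (3,2,1), (5,1)` — inside `S₅(b) = Stab(6)`: `(3,1,1), (3,2), (5)`, the classes with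
`a_p` odd used by the residual-image certificates (Remark 2.2.4: orders and traces of Frobenius). [folklore]
(consistent with [BPPTVY, Lemma 5.1.5, (5.1.8) p. 1173]) -/
theorem trace_iota_eq_card_fixed (σ : Perm (Fin 6)) :
    Matrix.trace (iota σ) = ((#{x | σ x = x} : ℕ) : ZMod 2) := by
  rw [trace_iota]; exact traceSum_eq_card_fixed σ

set_option maxRecDepth 200000 in
/-- KERNEL CHECK over all of `S₆` (`decide +kernel`): every `σ` fixing the letter `6` with `σ⁶ = 1`,
`σ² ≠ 1` has `∑ₗ F_{l,σ(l)} = 1`. [cite: BrumerEtAl2019, Lemma 5.1.7 (5.1.8) p. 1173] -/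
theorem S5b_traceSum_eq_one : ∀ σ : Perm (Fin 6), σ 5 = 5 → σ ^ 6 = 1 → σ ^ 2 ≠ 1 →
    (∑ l, F6 l (σ l)) = 1 := by
  decide +kernel

/-- **(5.1.8) for every element**: in `S₅(b) = ι(Stab_{S₆}(6))` ([BPPTVY, Example 5.1.9]: `S₅(b)`
is generated by the images of `(1 2 3 4 5), (1 2), (1 2 3)`, i.e. it is the image of the standard
`S₅ = Stab(6)`), "elements of order `3, 6` have trace `1`". [cite: BrumerEtAl2019, Lemma 5.1.7 (5.1.8) p. 1173] -/
theorem trace_eq_one_of_mem_S5b {σ : Perm (Fin 6)} (h6 : σ 5 = 5)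
    (hord : orderOf σ = 3 ∨ orderOf σ = 6) : Matrix.trace (iota σ) = 1 := by
  rw [trace_iota]
  refine S5b_traceSum_eq_one σ h6 ?_ ?_
  · have hdvd : orderOf σ ∣ 6 := by rcases hord with h | h <;> norm_num [h]
    exact orderOf_dvd_iff_pow_eq_one.mp hdvd
  · intro h2
    have hd := orderOf_dvd_of_pow_eq_one h2
    rcases hord with h | h <;> norm_num [h] at hd

/-- The other class of order-3 elements: `(1 2 3)(4 5 6) ∉ S₅(b)` has `tr ι = 0` — the trace that the
outer automorphism of `S₆` exchanges with that of the 3-cycles (so `S₅(a) = S₅(b)^{out}` has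
"elements of order 3, 6 of trace 0"). [cite: BrumerEtAl2019, Lemma 5.1.7 p. 1173] -/
theorem trace_c123_c456 :
    Matrix.trace (iota (c[(0 : Fin 6), 1, 2] * c[(3 : Fin 6), 4, 5])) = 0 ∧
      Matrix.trace (iota c[(0 : Fin 6), 1, 2]) = 1 := by
  unfold iota projZ basisZ permAction
  constructor <;> decide

end Literature.NumberTheory.FaltingsSerre.GSp4F2
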